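import Mathlib
import HarnessLib
import Summits.HubbardSuperconductivity.HubbardSuperconductivity.Theorems.KLProgrammeKLRegimeEngineTowerWtReadoutInc
import Summits.HubbardSuperconductivity.HubbardSuperconductivity.Theorems.KLProgrammeKLRegimeEngineTowerLevReadoutIncrJump
import Summits.HubbardSuperconductivity.HubbardSuperconductivity.Theorems.KLProgrammeKLRegimeEngineTowerLevReadoutFit
import Summits.HubbardSuperconductivity.HubbardSuperconductivity.Theorems.KLProgrammeKLRegimeEngineWtBudget

/-!
# Route `KLProgramme` — crux K3 ENGINE (stmt-HubbardSuperconductivity-20437 `KLRegimeEngineV17F2`), stub (b) v2, THE WEIGHTED HALF «(b)-WT4»: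
# W7b — THE WEIGHTED READ-OUT FIT: `klWtPinnedSum … (K_n) j (2p) q w ≤ klWtBudget P Q U j (2p)` at every level `d·K_b ≤ j ≤ d·K_b + d` and every degree
# `8 ≤ 2p ≤ 2D`, from the weighted law on the blocks `2 … K_b`, its exported rows at block `K_b`, the base datum rows and ONE `CE` threshold
# (cell gate-hubbard-kl, seat hubbard-kl-k3c3-p2 g17; W6 RO-1ʷ + W7a RO-2ʷ + this lineage's generic fit `towerReadout_le_of_ro_mul` / `readoutBracket_le_law_mul` /
#  `readoutLev_le_levelsRHS` (g16, track `0`) + E1's `klWtBudget_two_mul_of_two_le`; E1 may rename or supersede)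

`𝒱_j = 𝒱_{dK_b} + (𝒱_j − 𝒱_{dK_b})`; in the floor unit of the public family the first summand is under `A_ro λ^{p−1} Q_ro^p` (W6) and the second under
`C_inc·D_inc^p` times the law's kit bracket at block `K_b` (W7a), whose Chernoff data are the law's EXPORTED profile rows and imports at block `K_b` with the SAME
`(A″, Q″, ι₁, ι₂, ι₃)` and the same five smallness rows; E1's part 7 (`towerReadout_le_of_ro_mul`) turns that into one geometric profile `A_tot·λ^{p−1}·Q_tot^p`
(`readoutBracket_le_law_mul`), and with `λ = B·ε_j` and the threshold `CE ≥ Q_tot·ε_x²·B·max 1 (A_tot/ε_x)` the size is below `klWtBudget P Q U j (2p) =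
CE^p·ε_j^{p−1}·2^{(3p−5)j}` (`readoutLev_le_levelsRHS` at track `0`, `klWtBudget_two_mul_of_two_le`):
  `C_inc = C₁′/C₂′`, `D_inc = max 1 C₂′²`, `A_ro = (C₁/C₂)(A_b + A)`, `Q_ro = C₂²·max Q′ Q_b`,
  `Q_tot = D_inc·max 1 (max Q_ro (max (4Q″) (2τψQ″)))`, `A_tot = A_ro + C_inc·(A″·x₁/(1−x₁) + e·ψ·(τY)·(y/(1−y)))`, `x₁ = 4σλQ″`, `Y = ι₁λ + ι₂/(2Q″) + ι₃/(4Q″²) + A″Q″/4`,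
  `y = Φ·τ·Y`.
* **`klWtPinnedSum_le_klWtBudget_of_wtLaw_klEng (d R c″)`** — `∃ C₁ C₂ Cκ Cb CJ C₁′ C₂′ > 0`, `R.WF2 → ∃ c₃′ U₀′`; see the theorem docstring for the binder list.
Compositions of landed theorems and real algebra; nothing about the model is asserted beyond them; nothing asserts (b), (ℓ), any stub, K3 or superconductivity.
References: BGM 2006 §2.8 (2.76)–(2.84), (2.93)–(2.98), Lemma 2.5 (2.98), §3 (3.2)–(3.8) [cite: BenfattoGiulianiMastropietro2006].
-/

noncomputable section

namespace Summit.HubbardSuperconductivity.HubbardSuperconductivity.Theorems.EngineV8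

set_option linter.dupNamespace false -- summit = problem name (single-conjunct summit), D-0017

open Classical
open Real Finset Literature.MathematicalPhysics.QuantumLattice Literature.Probability.LatticeModels GrassmannAlgebra
open Literature.MathematicalPhysics.QuantumLattice.FermiRG Literature.MathematicalPhysics.QuantumLattice.FermiRG.BGM2006Routing
open Summit.HubbardSuperconductivity.HubbardSuperconductivity.Theorems.KLProgrammeLegKernels
open Summit.HubbardSuperconductivity.HubbardSuperconductivity.Theorems.KLRegimeSplit
open Summit.HubbardSuperconductivity.HubbardSuperconductivity.Theorems.KLRegimeWick
open Summit.HubbardSuperconductivity.HubbardSuperconductivity.Theorems.TwoPointAssembly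
open Summit.HubbardSuperconductivity.HubbardSuperconductivity.Theorems.DispersionFlow
open Summit.HubbardSuperconductivity.HubbardSuperconductivity.Theorems.TorusFourierL2

variable {L M : ℕ} [NeZero L] [NeZero M]

set_option maxHeartbeats 400000 in -- one ~120-binder composition of five landed theorems
/-- **THE WEIGHTED CLAUSE AT ONE READ-OUT LEVEL FROM THE WEIGHTED LAW** (see the module docstring).  On `K_n`, for `2 ≤ d`, `1 ≤ K_b`, `d·K_b ≤ j ≤ n`,
`j ≤ d·K_b + d`, a cap `3 ≤ D ≥ card(F_{dK_b−1})/2`, `Z^{K_n}_{Λ_{dK_b}} ≠ 0`; the base datum rows `N_b` at `(F_{d−1}, rate j)` with unit law `(A_b, Q_b)`; the law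
`Aλ^{p−1}Q′^p` on the born arrays of the blocks `2 ≤ k ≤ K_b` at rate `j`; dominants `κ̄ ᾱ c̄r c̄c` of the read-out's constants and the names `W Z σ τ ψ Φ` of W2;
the exported profile rows `μ̄_{K_b} m ≤ A″λ^{m−1}Q″^m` (`4 ≤ m ≤ D`) and imports `ι₁ ι₂ ι₃` at block `K_b`; the five smallness rows at `(A″, Q″)`; `λ = B·ε_j`, `1 ≤ B`;
`A_tot, Q_tot` by equations; and the threshold `Q_tot·ε_x²·B·max 1 (A_tot/ε_x) ≤ Qe.CE`: then for every `4 ≤ p ≤ D` and every pin,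
`klWtPinnedSum L M β U μ (K_n) j (2p) q w ≤ klWtBudget P Qe U j (2p)`. [cite: BenfattoGiulianiMastropietro2006, §2.8 (2.93)-(2.98), Lemma 2.5 (2.98)] -/
theorem klWtPinnedSum_le_klWtBudget_of_wtLaw_klEng (d : ℕ) (R : RenConsts) (c'' : ℝ) (hc'' : 0 < c'') :
    ∃ C₁ C₂ Cκ Cb CJ C₁' C₂' : ℝ, 0 < C₁ ∧ 0 < C₂ ∧ 0 < Cκ ∧ 0 < Cb ∧ 0 < CJ ∧ 0 < C₁' ∧ 0 < C₂' ∧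
      (R.WF2 → ∃ c₃' : ℝ, 0 < c₃' ∧ ∃ U₀' : ℝ, 0 < U₀' ∧
      ∀ (G : GeoConsts) (P : SplitConsts) (Q : EngConsts) (c : ℝ), P.WF → 0 < c → c ≤ klEngC₃6 P R → c ≤ c₃' →
      ∀ μ ∈ klWindowC, ∀ U : ℝ, 0 < U → U ≤ klEngU₀9 P R c → U ≤ U₀' → c'' * U ≤ 1 →
      ∀ β : ℝ, klBetaMin ≤ β → β ≤ Real.exp (c / U ^ 2) →
      ∀ (L M : ℕ) [NeZero L] [NeZero M], klEngL₃ β U ≤ L → klEngM₃ β U L ≤ M →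
      ∀ n : ℕ, 1 ≤ n → n ≤ nScales β + 1 → IsKLRegime U c (-(n : ℤ)) → HistP klPredsV17F2 L M G P Q R β U μ 0 n →
        (∀ m', 1 ≤ m' → m' < n → FlowPieceOscAt L M c'' β U μ m') →
      2 ≤ d → ∀ Kb j : ℕ, 1 ≤ Kb → d * Kb ≤ j → j ≤ n → j ≤ d * Kb + d →
      ∀ D : ℕ, 3 ≤ D → Fintype.card (SpaceTimeIdx L M × SectorLeg (sectorCount (d * Kb - 1))) / 2 ≤ D →
      hubbardEffPartitionFnCT L M β U μ 0 (klFlowFrameU L M β U μ n) (klScale klE0 (d * Kb)) ≠ 0 →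
      ∀ (B A lam Q' Ab Qb : ℝ), 1 ≤ B → lam = B * epsCoupling P U j → 0 ≤ A → 0 < lam → 0 < Q' → 0 ≤ Ab → 0 ≤ Qb →
      -- the base datum rows at `(F_{d−1}, rate j)`
      ∀ Nb : ℕ → ℝ, (∀ p, 0 ≤ Nb p) →
        (∀ (p : ℕ) (q : Fin (2 * p)) (w' : SpaceTimeIdx L M × SectorLeg (sectorCount (d - 1))),
          klWtPinnedSumAt L M β μ (klFlowFrameU L M β U μ n) (d - 1) j (2 * p) (klTowerInput L M β U μ (klFlowFrameU L M β U μ n) d 1) q w' ≤ Nb p) →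
        (∀ p : ℕ, 3 ≤ p → Nb p / klLevUnitF β M 0 p (d - 1) ≤ Ab * lam ^ (p - 1) * Qb ^ p) →
      -- the weighted law on the born arrays of the blocks `2 … K_b` at rate `j`
      (∀ k' : ℕ, 2 ≤ k' → k' ≤ Kb → ∀ p : ℕ, 3 ≤ p → p ≤ D →
        klTowerBornWtAt L M β U μ (klFlowFrameU L M β U μ n) d (k' - 1) j (2 * p) / klLevUnitF β M 0 p (d * (k' - 1)) ≤ A * lam ^ (p - 1) * Q' ^ p) →
      -- dominants of the read-out's constants and the names
      ∀ (κb αb crb ccb : ℝ), Real.sqrt (2 * Cκ * klE0) ≤ κb → Cb * ((M : ℝ) / β) * (4 : ℝ) ^ d / klE0 ≤ αb →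
        81 * CJ * M / β ≤ crb → 162 * CJ * M / β ≤ ccb →
      ∀ (W Z σ τ ψ Φ : ℝ),
        W = 32 * crb / ccb → Z = imagTimeWeight β M ^ 2 * ccb ^ 2 / 8 →
        σ = κb ^ 2 / ccb ^ 2 → τ = 4 * exp 4 * κb ^ 2 / ccb ^ 2 → ψ = ccb ^ 2 / κb ^ 2 → Φ = exp 1 * αb * ccb / (κb ^ 2 * crb) →
      -- the exported profile rows and the imports at block `K_b`
      ∀ (A'' Q'' ι₁ ι₂ ι₃ : ℝ), 0 ≤ A'' → 0 < Q'' →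
      (∀ m, 4 ≤ m → m ≤ D → W * Z ^ m *
        (klTowerMeasWtAt L M β U μ (klFlowFrameU L M β U μ n) d Kb j (2 * m) / klLevUnitF β M 0 m (d * Kb - 1)) ≤ A'' * lam ^ (m - 1) * Q'' ^ m) →
      W * Z ^ 1 * (klTowerMeasWtAt L M β U μ (klFlowFrameU L M β U μ n) d Kb j (2 * 1) / klLevUnitF β M 0 1 (d * Kb - 1)) ≤ ι₁ * lam →
      W * Z ^ 2 * (klTowerMeasWtAt L M β U μ (klFlowFrameU L M β U μ n) d Kb j (2 * 2) / klLevUnitF β M 0 2 (d * Kb - 1)) ≤ ι₂ * lam →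
      W * Z ^ 3 * (klTowerMeasWtAt L M β U μ (klFlowFrameU L M β U μ n) d Kb j (2 * 3) / klLevUnitF β M 0 3 (d * Kb - 1)) ≤ ι₃ * lam ^ 2 →
      -- the five smallness rows
      4 * σ * lam * Q'' < 1 → 2 * lam * τ * Q'' ≤ 1 → exp 1 * τ * lam * Q'' < 1 →
      Φ * (τ * (ι₁ * lam + ι₂ / (2 * Q'') + ι₃ / (4 * Q'' ^ 2) + A'' * Q'' / 4)) < 1 →
      Φ * (exp 1 * τ * (ι₁ * lam) + (exp 1 * τ) ^ 2 * (ι₂ * lam) + (exp 1 * τ) ^ 3 * (ι₃ * lam ^ 2) +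
        A'' * (exp 1 * τ * Q'') * ((exp 1 * τ * lam * Q'') ^ 3 / (1 - exp 1 * τ * lam * Q''))) < 1 →
      -- the read-out constants and the `CE` threshold
      ∀ (Atot Qtot : ℝ),
        Qtot = max 1 (C₂' ^ 2) * max 1 (max (C₂ ^ 2 * max Q' Qb) (max (4 * Q'') (2 * τ * ψ * Q''))) →
        Atot = C₁ / C₂ * (Ab + A) + C₁' / C₂' * (A'' * (4 * σ * lam * Q'' / (1 - 4 * σ * lam * Q'')) +
          exp 1 * ψ * (τ * (ι₁ * lam + ι₂ / (2 * Q'') + ι₃ / (4 * Q'' ^ 2) + A'' * Q'' / 4)) *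
            (Φ * (τ * (ι₁ * lam + ι₂ / (2 * Q'') + ι₃ / (4 * Q'' ^ 2) + A'' * Q'' / 4)) /
              (1 - Φ * (τ * (ι₁ * lam + ι₂ / (2 * Q'') + ι₃ / (4 * Q'' ^ 2) + A'' * Q'' / 4))))) →
      ∀ Qe : EngConsts, Qtot * imagTimeWeight β M ^ 2 * B * max 1 (Atot / imagTimeWeight β M) ≤ Qe.CE →
      ∀ p : ℕ, 4 ≤ p → p ≤ D → ∀ (q : Fin (2 * p)) (w : SpaceTimeIdx L M × SectorLeg (sectorCount j)),
        klWtPinnedSum L M β U μ (klFlowFrameU L M β U μ n) j (2 * p) q w ≤ klWtBudget P Qe U j (2 * p)) := by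
  obtain ⟨C₁, C₂, hC₁, hC₂, hro⟩ := readoutWt_ro_le_profile_klEng R c'' hc''.le
  obtain ⟨Cκ, Cb, CJ, C₁', C₂', hCκ, hCb, hCJ, hC₁', hC₂', hinc⟩ := readoutWt_inc_le_kit_klEng d R c'' hc''
  refine ⟨C₁, C₂, Cκ, Cb, CJ, C₁', C₂', hC₁, hC₂, hCκ, hCb, hCJ, hC₁', hC₂', fun hR2 => ?_⟩
  obtain ⟨c₃a, hc₃a, U₀a, hU₀a, hro'⟩ := hro hR2
  obtain ⟨c₃b, hc₃b, U₀b, hU₀b, hinc'⟩ := hinc hR2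
  refine ⟨min c₃a c₃b, lt_min hc₃a hc₃b, min U₀a U₀b, lt_min hU₀a hU₀b, ?_⟩
  intro G P Q c hP hc hc6 hc₃' μ hμ U hU hU9 hU₀' hcU β hβmin hβc L M _ _ hL3 hM3 n hn1 hnN hkl hhist hosc hd Kb j hKb1 hKbj hjn hjd D hD3 hD hZ
    B A lam Q' Ab Qb hB hlamB hA hlam hQ hAb hQb Nb hNb0 hcar hlawb hIH κb αb crb ccb hκb hαb hcrb hccb W Z σ τ ψ Φ hW hZ' hσ hτ hψ hΦ
    A'' Q'' ι₁ ι₂ ι₃ hA'' hQ'' hprof hι₁ hι₂ hι₃ hx₁ hx₂ hx₃ hy hθ Atot Qtot hQtot hAtot Qe hCE p hp hpD q w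
  obtain ⟨p', rfl⟩ : ∃ p', p = p' + 1 := ⟨p - 1, by omega⟩
  have he : (0 : ℝ) < klE0 := by norm_num [klE0]
  have hβ : 0 < β := KLRegimeSplit.pos_of_klBetaMin_le hβmin
  have hM0 : (0 : ℝ) < M := Nat.cast_pos.2 (Nat.pos_of_ne_zero (NeZero.ne M))
  have hx : 0 < imagTimeWeight β M := imagTimeWeight_pos_of_pos (M := M) hβ
  have hK1 : 1 ≤ P.Klam := hP.1
  have hKl : 0 ≤ P.Klam := le_trans zero_le_one hK1
  have hU3g : U ≤ min (klEngU₀3 P R c) (1 / (R.Gfr 3 + 1)) :=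
    le_min (hU9.trans (klEngU₀9_le_klEngU₀3 P R c)) (hU9.trans (klEngU₀9_le_inv_gfr_add_one P hR2.wf c (by norm_num)))
  obtain ⟨hc₃a', hc₃b'⟩ : c ≤ c₃a ∧ c ≤ c₃b := le_min_iff.1 hc₃'
  obtain ⟨hU₀a', hU₀b'⟩ : U ≤ U₀a ∧ U ≤ U₀b := le_min_iff.1 hU₀'
  set K : TrigPolyC4v := klFlowFrameU L M β U μ n with hKdef
  -- constants and names
  have hsq0 : 0 < Real.sqrt (2 * Cκ * klE0) := Real.sqrt_pos.2 (by positivity)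
  have hκb0 : 0 < κb := lt_of_lt_of_le hsq0 hκb
  have hαb0 : 0 < αb := lt_of_lt_of_le (by positivity) hαb
  have hcrb0 : 0 < crb := lt_of_lt_of_le (by positivity) hcrb
  have hccb0 : 0 < ccb := lt_of_lt_of_le (by positivity) hccb
  have hW0 : 0 < W := by rw [hW]; positivity
  have hZ0 : 0 < Z := by rw [hZ']; positivity
  have hσ0 : 0 ≤ σ := by rw [hσ]; positivity
  have hτ0 : 0 < τ := by rw [hτ]; positivity
  have hψ0 : 0 ≤ ψ := by rw [hψ]; positivity
  have hΦ0 : 0 ≤ Φ := by rw [hΦ]; positivity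
  -- the measured array at block `K_b` and the sign of the imports
  set μb : ℕ → ℝ := fun m => W * Z ^ m * (klTowerMeasWtAt L M β U μ K d Kb j (2 * m) / klLevUnitF β M 0 m (d * Kb - 1)) with hμb
  have hμb0 : ∀ m, 0 ≤ μb m := fun m => towerMuWt_nonneg hβ U μ K d Kb j m hW0.le hZ0.le
  have hι₁' : μb 1 ≤ ι₁ * lam := hι₁
  have hι₂' : μb 2 ≤ ι₂ * lam := hι₂
  have hι₃' : μb 3 ≤ ι₃ * lam ^ 2 := hι₃
  have hι₁0 : 0 ≤ ι₁ := (mul_nonneg_iff_of_pos_right hlam).1 ((hμb0 1).trans hι₁')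
  have hι₂0 : 0 ≤ ι₂ := (mul_nonneg_iff_of_pos_right hlam).1 ((hμb0 2).trans hι₂')
  have hι₃0 : 0 ≤ ι₃ := (mul_nonneg_iff_of_pos_right (pow_pos hlam 2)).1 ((hμb0 3).trans hι₃')
  -- the public size in floor units splits as `ro + inc`
  have hu : 0 < klLevUnitF β M 0 (p' + 1) j := klLevUnitF_pos hβ 0 (p' + 1) j
  set pubX : ℝ := klWtPinnedSum L M β U μ K j (2 * (p' + 1)) q w with hpubX
  set roX : ℝ := klWtPinnedSumAt L M β μ K j j (2 * (p' + 1)) (klTowerInput L M β U μ K d Kb) q w with hroX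
  set incX : ℝ := klWtPinnedSumAt L M β μ K j j (2 * (p' + 1)) (klEffectiveAction L M β U μ K klE0 j - klTowerInput L M β U μ K d Kb) q w with hincX
  have hsplit : pubX ≤ roX + incX := by
    have hdec : klEffectiveAction L M β U μ K klE0 j = klTowerInput L M β U μ K d Kb + (klEffectiveAction L M β U μ K klE0 j - klTowerInput L M β U μ K d Kb) := by
      abel
    rw [hpubX, ← klWtPinnedSumOf_klEffectiveAction, ← klWtPinnedSumAt_self, hdec]
    exact klWtPinnedSumAt_add_le hβ.le μ K j j (2 * (p' + 1)) _ _ q w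
  -- (ro) the re-measured input under `A_ro λ^{p−1} Q_ro^p`
  have hroB := hro' G P Q c hc hc6 hc₃a' μ hμ U hU hU3g hU₀a' hcU β hβmin hβc L M hL3 hM3 n hn1 hnN hkl hhist hosc d Kb j hd hKb1 hKbj hjn D
    A lam Q' Ab Qb hA hlam.le hQ.le hAb hQb Nb hNb0 hcar hlawb hIH (p' + 1) hp hpD q w
  -- (inc) the partial increment under `C_inc·D_inc^p·kit(μ̄)` for every truncation `N ≥ 2` under the guard
  have hstep : ∀ N : ℕ, 2 ≤ N → Φ * towerV D τ μb < 1 →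
      incX / klLevUnitF β M 0 (p' + 1) j ≤ C₁' / C₂' * (max 1 (C₂' ^ 2)) ^ (p' + 1) *
        (towerFO D σ μb (p' + 1) + ∑ n' ∈ Icc 2 N, exp 1 * Φ ^ (n' - 1) * ψ ^ (p' + 1) * towerS D τ μb n' (p' + 1) +
          ψ ^ (p' + 1) * exp 1 * towerV D τ μb * (Φ * towerV D τ μb) ^ N / (1 - Φ * towerV D τ μb)) := by
    intro N hN hguard
    rw [hincX]
    exact hinc' G P Q c hP hc hc6 hc₃b' μ hμ U hU hU9 hU₀b' hcU β hβmin hβc L M hL3 hM3 n hn1 hnN hkl hhist hosc hd Kb j hKb1 hKbj hjn hjd D hD hZ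
      κb αb crb ccb hκb hαb hcrb hccb W Z σ τ ψ Φ hW hZ' hσ hτ hψ hΦ N (by omega) p' (by omega) hguard q w
  -- E1's part 7 fit and the bracket under one law
  have hCinc : 0 < C₁' / C₂' := by positivity
  have hDinc : 0 < max 1 (C₂' ^ 2) := lt_of_lt_of_le one_pos (le_max_left _ _)
  have hDinc1 : 1 ≤ max 1 (C₂' ^ 2) := le_max_left _ _
  have hfit := towerReadout_le_of_ro_mul (D := D) (μ := μb) (pub := pubX / klLevUnitF β M 0 (p' + 1) j) (ro := roX / klLevUnitF β M 0 (p' + 1) j)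
    (inc := incX / klLevUnitF β M 0 (p' + 1) j) hσ0 hΦ0 hψ0 hτ0 hlam hA'' hQ'' hCinc hDinc hμb0 hι₁' hι₂' hι₃' hprof hx₁ hx₂ hx₃ hy hθ (by omega)
    (by rw [← add_div]; exact div_le_div_of_nonneg_right hsplit hu.le) hroB hstep
  have hX₁ : 0 ≤ 4 * σ * lam * Q'' / (1 - 4 * σ * lam * Q'') := div_nonneg (by positivity) (sub_nonneg.2 hx₁.le)
  have hY0 : 0 ≤ ι₁ * lam + ι₂ / (2 * Q'') + ι₃ / (4 * Q'' ^ 2) + A'' * Q'' / 4 := by positivity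
  have hTY : 0 ≤ τ * (ι₁ * lam + ι₂ / (2 * Q'') + ι₃ / (4 * Q'' ^ 2) + A'' * Q'' / 4) := by positivity
  have hYy : 0 ≤ Φ * (τ * (ι₁ * lam + ι₂ / (2 * Q'') + ι₃ / (4 * Q'' ^ 2) + A'' * Q'' / 4)) /
      (1 - Φ * (τ * (ι₁ * lam + ι₂ / (2 * Q'') + ι₃ / (4 * Q'' ^ 2) + A'' * Q'' / 4))) := div_nonneg (by positivity) (sub_nonneg.2 hy.le)
  have hAro0 : 0 ≤ C₁ / C₂ * (Ab + A) := by positivity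
  have hQro0 : 0 ≤ C₂ ^ 2 * max Q' Qb := by have : 0 ≤ max Q' Qb := le_max_of_le_left hQ.le; positivity
  have hbr := readoutBracket_le_law_mul (Aro := C₁ / C₂ * (Ab + A)) (Qro := C₂ ^ 2 * max Q' Qb) hAro0 hQro0 hA'' hQ''.le hψ0 hτ0.le hX₁ hTY hYy
    hCinc.le hDinc1 (p' + 1)
  -- the law-shaped bound in floor units
  have hAtot0 : 0 ≤ Atot := by rw [hAtot]; positivity
  have hQtot0 : 0 ≤ Qtot := by
    rw [hQtot]; exact mul_nonneg hDinc.le (le_trans zero_le_one (le_max_left _ _))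
  have hlawX : pubX / klLevUnitF β M 0 (p' + 1) j ≤ Atot * (B * epsCoupling P U j) ^ (p' + 1 - 1) * Qtot ^ (p' + 1) := by
    rw [← hlamB]
    have h1 := hfit.trans (mul_le_mul_of_nonneg_left hbr (pow_nonneg hlam.le _))
    rw [hAtot, hQtot]
    refine h1.trans (le_of_eq ?_)
    ring
  -- the registered weighted budget
  have hfinal := readoutLev_le_levelsRHS (M := M) (P := P) hβ hKl U hAtot0 hQtot0 hB hCE 0 (by omega) j (X := pubX) hlawX
  rw [show levelGainExp (((0 : Fin 5) : ℕ) + 1) = 0 from rfl, pow_zero, mul_one] at hfinal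
  rw [klWtBudget_two_mul_of_two_le P Qe U j (by omega : 2 ≤ p' + 1)]
  exact hfinal

end Summit.HubbardSuperconductivity.HubbardSuperconductivity.Theorems.EngineV8

end
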